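/-
Copyright (c) 2026. All rights reserved.
Released under Apache 2.0 license as described in the file LICENSE.
Authors: abc-iut cell, wave-5 seat abc-iut-w5-d141 (L3 sub-DAG [SemiAnbd] Thm 5.4, rows T54-6/T54-7: `hinj`).
-/
import Literature.AnabelianGeometry.SemiGraphs.ArithmeticCoverings
import HarnessLib

/-!
# [SemiAnbd] Theorem 5.4 (iii), clause 2 residual `hinj`: injectivity of `φ ↦ B^temp(φ)` from the geometric side
# (sub-DAG SemiAnbd-Thm54, rows T54-6 → T54-7; proof-only)

Mochizuki, *Semi-graphs of anabelioids*, Publ. RIMS **42** (2006), §5, Thm 5.4 (iii), p. 66 ("natural bijective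
correspondence"; proof "entirely parallel to … Corollary 3.9") [cite: MochizukiSemiAnbd2006, Thm 5.4 (iii), p. 66].

PROOF-ONLY.  The coordinator's umbrella `arithQuasiGeometricCorrespondenceStatement_of_rows` (abc-iut-w4-d085,
`ArithThm54iiiAssembly.lean`) takes clause 2 from abc-iut-w4-d082's reduction modulo the residual binder
`hinj` ("two locally open morphisms over `A` whose `B^temp`'s are conjugate are equal").  This file DISCHARGES
`hinj` (`Thm54iii.hinj_of_geometric`) from the same geometric inputs as clause 3 (`ArithQuasiGeometricSurjective.lean`,
abc-iut-w5-d141): the datum `ι = B^temp(−)` on the geometric tempered groups with its injectivity up to geometric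
inner automorphisms (`hιinj`, Cor 3.9 "bijective") and its tie to the arithmetic `B^temp` (`hιbtemp`), `B^temp(φ)`
over `A` (`hover`), surjectivity of `augG` (Prop 5.2 (iv)) and SLIMNESS of `π̂₁(A)` (Def 5.1 (i): the centre of
`Π_A` is trivial, so a conjugator intertwining two homomorphisms over `A` is geometric).  Nothing asserted; no
side on [IUTchIII] Cor 3.12.
-/

namespace Literature.AnabelianGeometry.SemiGraphs

open _root_.CategoryTheory
open Literature.AlgebraicGeometry.Frobenioids (IsSlimGroup)

universe u v w uG uH

variable {Obj : Type u} [Category.{v} Obj] {𝓥 : SemiAnbdVocab.{u, v, w} Obj}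
variable {𝔊 ℍ : ArithSemiGraph 𝓥} {e : 𝔊.PA ≃* ℍ.PA}
variable {Gtp : Type uG} [Group Gtp] [TopologicalSpace Gtp]
variable {Htp : Type uH} [Group Htp] [TopologicalSpace Htp]

omit [TopologicalSpace Gtp] [TopologicalSpace Htp] in
/-- Over a SLIM `Π_A`, a conjugator intertwining two homomorphisms over `A` (with `augG` surjective) is
geometric: it lies in `Ker augH'`. [cite: MochizukiSemiAnbd2006, Thm 5.4 (iii), p. 66] -/
theorem conjugator_mem_ker_of_over {augG : Gtp →* 𝔊.PA} {augH' : Htp →* 𝔊.PA} {f F : Gtp →* Htp}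
    (hf : augH'.comp f = augG) (hF : augH'.comp F = augG) (hsurjG : Function.Surjective augG)
    (hslimA : IsSlimGroup 𝔊.PA) {h : Htp} (hh : ∀ g, F g = h * f g * h⁻¹) : h ∈ augH'.ker := by
  have hcen : augH' h ∈ Subgroup.centralizer ((⊤ : Subgroup 𝔊.PA) : Set 𝔊.PA) := by
    rw [Subgroup.mem_centralizer_iff]
    intro a _
    obtain ⟨γ, rfl⟩ := hsurjG a
    have h1 : augH' (F γ) = augH' (h * f γ * h⁻¹) := by rw [hh]
    rw [map_mul, map_mul, map_inv, ← MonoidHom.comp_apply, ← MonoidHom.comp_apply, hf, hF] at h1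
    -- `augG γ = augH' h * augG γ * (augH' h)⁻¹`
    calc augG γ * augH' h = augH' h * augG γ * (augH' h)⁻¹ * augH' h := by rw [← h1]
      _ = augH' h * augG γ := by group
  rw [hslimA.centralizer_eq_bot ⊤ (by simp), Subgroup.mem_bot] at hcen
  exact hcen

/-- Two arithmetic morphisms with the same components are equal. [cite: MochizukiSemiAnbd2006, Def 5.1 (iv), p. 63] -/
theorem ArithHom.ext_of_components {φ ψ : ArithHom 𝓥 𝔊 ℍ} (ha : φ.arith = ψ.arith) (hg : φ.geom = ψ.geom) :
    φ = ψ := by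
  rcases φ with ⟨a₁, c₁, g₁, p₁⟩
  rcases ψ with ⟨a₂, c₂, g₂, p₂⟩
  simp only at ha hg
  subst ha; subst hg
  rfl

omit [TopologicalSpace Gtp] [TopologicalSpace Htp] in
/-- **The clause-2 residual `hinj` of the umbrella, from the geometric side**: two locally open morphisms
`φ, ψ : 𝔊 → ℍ` over `A` whose `B^temp`'s are conjugate in `Π^temp_ℍ` are EQUAL — the conjugator is geometric by
slimness of `Π_A` (`conjugator_mem_ker_of_over`), so the geometric components induce conjugate (by a geometric
element) homomorphisms on `Π^temp_𝔾` (`hιbtemp`), hence coincide (`hιinj`, Cor 3.9 injectivity); the arithmetic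
components are both `e`. [cite: MochizukiSemiAnbd2006, Thm 5.4 (iii), p. 66] -/
theorem Thm54iii.hinj_of_geometric (augG : Gtp →* 𝔊.PA) (augH' : Htp →* 𝔊.PA)
    (btemp : (φ : ArithHom 𝓥 𝔊 ℍ) → φ.IsLocallyOpen → ArithHom.IsOverA 𝔊 ℍ e φ → (Gtp →* Htp))
    (hover : ∀ (φ : ArithHom 𝓥 𝔊 ℍ) (h₁ : φ.IsLocallyOpen) (h₂ : ArithHom.IsOverA 𝔊 ℍ e φ),
      augH'.comp (btemp φ h₁ h₂) = augG)
    (ι : (𝔊.G ⟶ ℍ.G) → (augG.ker →* Htp))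
    (hιinj : ∀ g₁ g₂ : 𝔊.G ⟶ ℍ.G,
      (∃ δ ∈ augH'.ker, ∀ x : augG.ker, ι g₁ x = δ * ι g₂ x * δ⁻¹) → g₁ = g₂)
    (hιbtemp : ∀ (φ : ArithHom 𝓥 𝔊 ℍ) (h₁ : φ.IsLocallyOpen) (h₂ : ArithHom.IsOverA 𝔊 ℍ e φ),
      ∃ δ ∈ augH'.ker, ∀ x : augG.ker, btemp φ h₁ h₂ x = δ * ι φ.geom x * δ⁻¹)
    (hsurjG : Function.Surjective augG) (hslimA : IsSlimGroup 𝔊.PA) :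
    ∀ (φ ψ : ArithHom 𝓥 𝔊 ℍ) (h₁ : φ.IsLocallyOpen) (h₂ : ArithHom.IsOverA 𝔊 ℍ e φ)
      (k₁ : ψ.IsLocallyOpen) (k₂ : ArithHom.IsOverA 𝔊 ℍ e ψ),
      (∃ h : Htp, ∀ g : Gtp, btemp ψ k₁ k₂ g = h * btemp φ h₁ h₂ g * h⁻¹) → φ = ψ := by
  intro φ ψ h₁ h₂ k₁ k₂ hconj
  obtain ⟨h, hh⟩ := hconj
  have hker : h ∈ augH'.ker :=
    conjugator_mem_ker_of_over (hover φ h₁ h₂) (hover ψ k₁ k₂) hsurjG hslimA hh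
  obtain ⟨δ₁, hδ₁, hb₁⟩ := hιbtemp φ h₁ h₂
  obtain ⟨δ₂, hδ₂, hb₂⟩ := hιbtemp ψ k₁ k₂
  -- the geometric components induce conjugate homomorphisms, by the geometric element `δ₂⁻¹ h δ₁`
  have hg : ψ.geom = φ.geom := by
    refine hιinj _ _ ⟨δ₂⁻¹ * h * δ₁, augH'.ker.mul_mem (augH'.ker.mul_mem (augH'.ker.inv_mem hδ₂) hker) hδ₁,
      fun x => ?_⟩
    have e1 := hh x
    rw [hb₁ x, hb₂ x] at e1
    -- `e1 : δ₂ * ι ψ.geom x * δ₂⁻¹ = h * (δ₁ * ι φ.geom x * δ₁⁻¹) * h⁻¹`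
    calc ι ψ.geom x = δ₂⁻¹ * (δ₂ * ι ψ.geom x * δ₂⁻¹) * δ₂ := by group
      _ = δ₂⁻¹ * (h * (δ₁ * ι φ.geom x * δ₁⁻¹) * h⁻¹) * δ₂ := by rw [e1]
      _ = δ₂⁻¹ * h * δ₁ * ι φ.geom x * (δ₂⁻¹ * h * δ₁)⁻¹ := by group
  have ha : φ.arith = ψ.arith := MonoidHom.ext fun a => (h₂ a).trans (k₂ a).symm
  exact ArithHom.ext_of_components ha hg.symm

end Literature.AnabelianGeometry.SemiGraphs
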